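import Summits.ABC.ABC.Theses.RibetTakahashiSplit
import Summits.ABC.ABC.Theses.DefiniteXi
import Summits.ABC.ABC.Theorems.RibetTakahashiSplitWeightedSzpiroBoundForgivenDegreeBoundOfDefiniteXi
import Summits.ABC.ABC.Theorems.RibetTakahashiSplitWeightedSzpiroBoundAbc
import Literature.NumberTheory.EllipticCurves.DegreeConjectureAbc
import Literature.NumberTheory.EllipticCurves.SilvermanHeightCovolumeProofs
import Literature.NumberTheory.EllipticCurves.SzpiroBGEquivalenceProofs

/-!
# Route RibetTakahashiSplit — crux `WeightedSzpiroBound` (stmt-ABC-3272) FROM route `DefiniteXi`'s items (conditional bridge)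

Conditional results (sorry-free; hypotheses are TAGGED route items of route `ABC/DefiniteXi`, no Literature named
fact is taken by name) recording where the line `two-adic-eisenstein-anchor` of this crux actually stands after its
first wave (lead prover-line-stmt-ABC-3272-0, 2026-08-16):

* (imported from `RibetTakahashiSplitWeightedSzpiroBoundAbc.lean`) `WeightedSzpiroBound.of_generalizedSzpiroBG` —
  generalized Szpiro (Bombieri–Gubler Conj. 12.5.11) implies the weighted crux (`T(E) ≥ 1`); and
  `WeightedSzpiroBound.iff_abc : WeightedSzpiroBound ↔ ABC`.
* `WeightedSzpiroBound.of_freyDegreeBound` — the crux from TWO items of route `DefiniteXi`: its target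
  `FreyDegreeBound` (stmt-ABC-2019: Frey's degree conjecture `∃ D, deg D ≤ C N^{2+ε}` on Frey curves) and
  `PeterssonLowerBound` (stmt-ABC-10870, verbatim the named fact `murty_petersson_newform_lower_bound`), through the
  tree's PROVED `abcLe_of_freyDegreeBound'` (Murty 1999 Thm 1 direction; Silverman's covolume inequality PROVED,
  `silverman1986_discriminant_c4_covolume_holds`) and `abcLe_iff_generalizedSzpiroBG_holds` (B–G 12.5.12).
* `WeightedSzpiroBound.freyDegreeBound_of_definiteXi` — `FreyDegreeBound` from `XiStrongBound` (stmt-ABC-11337),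
  `DefiniteRTControlPrime` (stmt-ABC-11338) and `FreyModularity` (stmt-ABC-11340): the glue `DefiniteGlue` is PROVED
  (`TwoAdicEisensteinAnchor.definiteGlue_holds`, landed with the line's stub 2′) and a minimal-degree datum exists by
  `Nat.find` (the content of DefiniteXi's item `MinimalBoundGivesTarget`, stmt-ABC-3328, proved here as
  `WeightedSzpiroBound.minimalBoundGivesTarget_holds`).
* `WeightedSzpiroBound.of_definiteXi` — the composition: `XiStrongBound → DefiniteRTControlPrime → FreyModularity →
  PeterssonLowerBound → WeightedSzpiroBound`.

* By-products for route `DefiniteXi`: its frame items `DegreeBoundToABCOfPetersson` (stmt-ABC-11342) and `Assembly`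
  (stmt-ABC-11339) hold (`…_holds`, one-liners over the tree).

HONEST NOTE.  This is the line's composition `TwoAdicEisensteinAnchor.WeightedSzpiroBound_of` with its one remaining
research stub (`stub_twoAdicAnchor`, the 2-adic Eisenstein anchor) REMOVED: once stub 2 is drawn from `DefiniteXi`
(stub 2′, landed) the full minimal-degree bound is available and the 2-adic split is not load-bearing.  So, as far as
anything provable today goes, crux r3′ of `RibetTakahashiSplit` is a CONDITIONAL BRIDGE to route `DefiniteXi`
(blocked on its crux `XiStrongBound`, ABC-strength); nothing here closes stmt-ABC-3272.
-/

noncomputable section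

-- `Summit.<Summit>.<Problem>` is the mandated summit-side namespace (CONVENTIONS §2); for the
-- single-conjunct summit `ABC` the two coincide, so the duplicate `ABC.ABC` is deliberate.
set_option linter.dupNamespace false

namespace Summit.ABC.ABC.Theorems

open Literature.NumberTheory
open Literature.NumberTheory.EllipticCurves
open Literature.NumberTheory.EllipticCurves.ModularForms
open Summit.ABC.ABC.Theses

/-- **The crux from Frey's degree conjecture and the Petersson lower bound** (two items of route `DefiniteXi`:
`FreyDegreeBound`, stmt-ABC-2019, and `PeterssonLowerBound`, stmt-ABC-10870).  Chain: `abcLe_of_freyDegreeBound'`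
(Frey–Mai–Murty, PROVED in the tree relative to the Petersson fact, with Silverman's covolume inequality discharged by
`silverman1986_discriminant_c4_covolume_holds`) gives `abc` in the `≤`-form; `abcLe_iff_generalizedSzpiroBG_holds`
(Bombieri–Gubler 12.5.12, PROVED) gives generalized Szpiro; `of_generalizedSzpiroBG` gives the crux. [folklore] -/
theorem WeightedSzpiroBound.of_freyDegreeBound (hP : DefiniteXi.PeterssonLowerBound)
    (hdeg : DefiniteXi.FreyDegreeBound) : RibetTakahashiSplit.WeightedSzpiroBound :=
  WeightedSzpiroBound.of_generalizedSzpiroBG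
    (abcLe_iff_generalizedSzpiroBG_holds.mp
      (abcLe_of_freyDegreeBound' hP silverman1986_discriminant_c4_covolume_holds hdeg))

/-- **DefiniteXi's glue item `MinimalBoundGivesTarget` (stmt-ABC-3328) holds**: if every Frey curve carries some datum
at its conductor level and every MINIMAL-degree datum obeys `deg ≤ C_ε N^{2+ε}`, then `FreyDegreeBound`.  A
minimal-degree datum exists by well-ordering of `ℕ` (`Nat.find`). [folklore] -/
theorem WeightedSzpiroBound.minimalBoundGivesTarget_holds : DefiniteXi.MinimalBoundGivesTarget := by
  intro hMod hmin ε hε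
  obtain ⟨C, hC⟩ := hmin ε hε
  refine ⟨C, fun a b hab h0 N _ hN ↦ ?_⟩
  have hne : ∃ d : ℕ, ∃ D : ModularParametrizationData (freyCurve a b) N, D.deg = d := by
    obtain ⟨D₀⟩ := hMod a b hab h0 N hN
    exact ⟨D₀.deg, D₀, rfl⟩
  classical
  obtain ⟨D, hD⟩ := Nat.find_spec hne
  have hDmin : ∀ D' : ModularParametrizationData (freyCurve a b) N, D.deg ≤ D'.deg := fun D' ↦ by
    rw [hD]; exact Nat.find_min' hne ⟨D', rfl⟩
  exact ⟨D, hC a b hab h0 N hN D hDmin⟩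

/-- **`FreyDegreeBound` from route `DefiniteXi`'s crux, comparison and modularity items**: `XiStrongBound`
(stmt-ABC-11337) and `DefiniteRTControlPrime` (stmt-ABC-11338) give the minimal-degree bound through the PROVED glue
`TwoAdicEisensteinAnchor.definiteGlue_holds` (item `DefiniteGlue`, stmt-ABC-11341), and `FreyModularity`
(stmt-ABC-11340) supplies a datum, hence a minimal one (`minimalBoundGivesTarget_holds`). [folklore] -/
theorem WeightedSzpiroBound.freyDegreeBound_of_definiteXi (hXS : DefiniteXi.XiStrongBound)
    (hRT : DefiniteXi.DefiniteRTControlPrime) (hMod : DefiniteXi.FreyModularity) :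
    DefiniteXi.FreyDegreeBound :=
  WeightedSzpiroBound.minimalBoundGivesTarget_holds hMod
    (TwoAdicEisensteinAnchor.definiteGlue_holds hXS hRT)

/-- **The crux of `RibetTakahashiSplit` from route `DefiniteXi`** (conditional bridge, sorry-free): the definite
quaternion bound `XiStrongBound` (stmt-ABC-11337, ABC-strength, OPEN), the definite Ribet–Takahashi comparison
`DefiniteRTControlPrime` (stmt-ABC-11338, Takahashi 2001 + Pasten Thm 6.1, known in print), modularity of Frey curves
in datum form `FreyModularity` (stmt-ABC-11340, Wiles/BCDT) and the Petersson lower bound `PeterssonLowerBound`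
(stmt-ABC-10870, Hoffstein–Lockhart/Murty) imply `WeightedSzpiroBound`.  This is the line
`two-adic-eisenstein-anchor`'s composition with its research stub (the 2-adic anchor) removed — that stub is not
load-bearing once the degree bound is drawn from `DefiniteXi`. [folklore] -/
theorem WeightedSzpiroBound.of_definiteXi (hXS : DefiniteXi.XiStrongBound)
    (hRT : DefiniteXi.DefiniteRTControlPrime) (hMod : DefiniteXi.FreyModularity)
    (hP : DefiniteXi.PeterssonLowerBound) : RibetTakahashiSplit.WeightedSzpiroBound :=
  WeightedSzpiroBound.of_freyDegreeBound hP (WeightedSzpiroBound.freyDegreeBound_of_definiteXi hXS hRT hMod)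

/-! ## By-products for route `DefiniteXi` (its frame items, provable now; closable there by `exact`) -/

/-- **DefiniteXi's frame item `DegreeBoundToABCOfPetersson` (stmt-ABC-11342) holds**: `PeterssonLowerBound →
FreyDegreeBound → ABC`, by the tree's `abcLt_of_freyDegreeBound` with Silverman's covolume inequality discharged
(`silverman1986_discriminant_c4_covolume_holds`). [folklore] -/
theorem WeightedSzpiroBound.degreeBoundToABCOfPetersson_holds : DefiniteXi.DegreeBoundToABCOfPetersson :=
  fun hP hdeg ↦ _root_.ABC_iff.mpr (abcLt_of_freyDegreeBound hP silverman1986_discriminant_c4_covolume_holds hdeg)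

/-- **DefiniteXi's `Assembly` (stmt-ABC-11339) holds** (it mirrors that route's deciding theorem):
`XiStrongBound → DefiniteRTControlPrime → DefiniteGlue → FreyModularity → MinimalBoundGivesTarget →
PeterssonLowerBound → DegreeBoundToABCOfPetersson → ABC`. [folklore] -/
theorem WeightedSzpiroBound.definiteXi_assembly_holds : DefiniteXi.Assembly :=
  fun hXS hRT hGlue hMod hMin hP hDeg ↦ hDeg hP (hMin hMod (hGlue hXS hRT))

end Summit.ABC.ABC.Theorems

end
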